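import Summits.QuantumFields.YangMills.Theorems.AllWindowsColdBoxBoxHighLineCum3TriangleBound
import Summits.QuantumFields.YangMills.Theorems.AllWindowsColdBoxBoxHighLineRestrictionSetCum3
import Summits.QuantumFields.YangMills.Theorems.AllWindowsColdBoxBoxHighLineTiltUMomentsPrelims
import Summits.QuantumFields.YangMills.Theorems.AllWindowsColdBoxBoxHighLinePlaqCostSizesOnD
import Summits.QuantumFields.YangMills.Theorems.AllWindowsColdBoxBoxHighLineTiltSupBounds

/-!
# `ConnectedThreePoint`, quadratic vertex — ON THE CUT SMALL-FIELD SET `μ_{D′}`: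
# `|κ₃,₀^{μ_{D′}}(L_p, L_q; quadVal M)| ≤ β⁻³·(C·C_M·(1+log H)⁵/(1+‖p−q‖₁)⁴) + √τ·C·(1+log H)²·H²·√(Σ M²)/β³`

Free-hands helper of the κ-lineage (ym-line-fcl-p3 g27), U5 prep (ASSEMBLY-U5 §3 L2 / K3′: «the μ_{D′} ↔ E₀ transfer of the exact pieces», the κ₃ twin of LEAD g78's
✓`…ConnectedFourPointCubicMuSet`).  w3 g41's ✓`Cum3Triangle.abs_gaussCum3_linCurvSq_linCurvSq_quadVal_le` bounds the RAW Gaussian third cumulant of two quadratic plaquette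
observables and a quadratic vertex `quadVal M` (kernel `|M i j| ≤ C_M/(1+d)⁴`: the ghost form `M_H` and the Haar form) under the FULL Gaussian `E₀`; the U5 assembler consumes
`κ₃,₀` over the restricted Gaussian `μ_{D′}`, `D′ ⊆ smallField H s` measurable with co-mass `E₀[1 − 1_{D′}] ≤ τ ≤ 1/2`.  This file moves the bound onto `μ_{D′}`:

* `GaussRestrict.gaussAvg_centred_triple_eq_cum3Raw` — generic: for measurable `G₁ G₂ P` with sixth moments, `E₀[(G₁−E₀G₁)(G₂−E₀G₂)(P−E₀P)]` IS the raw five-term expression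
  (so ✓`abs_tiltCum3_muSet_zero_sub_gaussAvg_centred_le` meets RAW-form Wick bounds);
* `GaussRestrict.measurable_quadVal`;
* ★★ `GaussRestrict.abs_tiltCum3_muSet_linCurvSq_linCurvSq_quadVal_le` — `∃ C ≥ 0, ∀ H ≥ 1, β > 0, C_M ≥ 0, M symmetric with |M i j| ≤ C_M/(1+siteDist)⁴, p q : Plaq 4 of the form
  (x,μ,ν), 0 ≤ s, D ⊆ smallField H s measurable, E₀[1 − 1_D] ≤ τ ≤ 1/2:`
  `|Tilt.tiltCum3 μ_D (quadVal M) 0 (linCurvSq H p) (linCurvSq H q)| ≤ β⁻¹^3·(C₃·C_M·(1+log H)⁵/(1+‖p−q‖₁)⁴) + √τ·(C·(1+log H)²·H²·√(Σ_{ij} M_{ij}²)/β³)`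
  (route: shift to the E₀-centred slots ✓`tiltCum3_muSet_zero_shift`, centred transfer with the seven sizes as PERFECT SQUARES from Bonami–Nelson
  ✓`gaussAvg_sq_mul_sq_le_of_polyCert` over ✓`gaussAvg_centred_linCurvSq_sq_le` (`C_V(1+log H)²/β²`) and ✓`gaussAvg_quadVal_centred_sq_le` (`C_b·H⁴/β²·ΣM²`);
  transfer error `1352·√τ·u²v`).

No definitions; standard axioms.  HONEST LABEL: glue for the RECORDED lift L2 of the NEXT rung U5 (⟨stmt-QuantumFields-24336⟩, UNSTAFFED; the rest of K3′ — parity split, the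
odd piece, the remainders by Hölder — is NOT here); ⟨24004⟩ ⟨24336⟩ remain OPEN; route AllWindowsColdBox is DRAFT; no crux, rung or summit is proved; **the Yang–Mills mass
gap is NOT proved by this file; no summit is proved by a line.**
-/

set_option autoImplicit false

noncomputable section

open MeasureTheory Matrix Finset
open Literature.Probability.LatticeModels (Site)

namespace Summit.QuantumFields.YangMills.Theorems.AllWindowsColdBoxBoxHighLine

namespace GaussRestrict

open EdgeChartGaussian (polyCert_const polyCert_sub polyCert_mul polyCert_pow polyCert_linCurvSq gaussAvg_sq_mul_sq_le_of_polyCert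
  gaussAvg_centred_linCurvSq_sq_le integrable_polyCert_mul_gaussWeight measurable_linCurvSq)
open LaplaceSandwich (flatten)

variable {H : ℕ} {β : ℝ}

/-! ## §1 The centred triple moment is the raw third-cumulant expression -/

/-- ★ **`E₀[(G₁−E₀G₁)(G₂−E₀G₂)(P−E₀P)] = E₀[G₁G₂P] − E₀G₁·E₀[G₂P] − E₀G₂·E₀[G₁P] − E₀P·E₀[G₁G₂] + 2·(E₀G₁·E₀G₂·E₀P)`** for measurable observables with
sixth moments under `E₀` (the right-hand side is the LHS shape of ✓`gaussCum3_quadVal` / ✓`Cum3Triangle.abs_gaussCum3_linCurvSq_linCurvSq_quadVal_le`). -/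
theorem gaussAvg_centred_triple_eq_cum3Raw (hβ : 0 < β) {G₁ G₂ P : (LandauFree H → E3) → ℝ} (h₁ : Measurable G₁) (h₂ : Measurable G₂)
    (hP : Measurable P) (i₁ : Integrable (fun a => G₁ a ^ 6 * gaussWeight β H a)) (i₂ : Integrable (fun a => G₂ a ^ 6 * gaussWeight β H a))
    (iP : Integrable (fun a => P a ^ 6 * gaussWeight β H a)) :
    gaussAvg β H (fun a => (G₁ a - gaussAvg β H G₁) * (G₂ a - gaussAvg β H G₂) * (P a - gaussAvg β H P)) =
      gaussAvg β H (fun a => G₁ a * G₂ a * P a) - gaussAvg β H G₁ * gaussAvg β H (fun a => G₂ a * P a) -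
        gaussAvg β H G₂ * gaussAvg β H (fun a => G₁ a * P a) - gaussAvg β H P * gaussAvg β H (fun a => G₁ a * G₂ a) +
        2 * (gaussAvg β H G₁ * gaussAvg β H G₂ * gaussAvg β H P) := by
  set m₁ := gaussAvg β H G₁
  set m₂ := gaussAvg β H G₂
  set b := gaussAvg β H P
  -- integrability of the seven monomials against the weight
  have j₁ : Integrable (fun a => G₁ a * gaussWeight β H a) := integrable_mul_gaussWeight_of_sq hβ h₁ (integrable_sq_mul_gaussWeight_of_six hβ h₁ i₁)
  have j₂ : Integrable (fun a => G₂ a * gaussWeight β H a) := integrable_mul_gaussWeight_of_sq hβ h₂ (integrable_sq_mul_gaussWeight_of_six hβ h₂ i₂)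
  have j₃ : Integrable (fun a => P a * gaussWeight β H a) := integrable_mul_gaussWeight_of_sq hβ hP (integrable_sq_mul_gaussWeight_of_six hβ hP iP)
  have m₁₂ : Measurable fun a => G₁ a * G₂ a := h₁.mul h₂
  have m₁₃ : Measurable fun a => G₁ a * P a := h₁.mul hP
  have m₂₃ : Measurable fun a => G₂ a * P a := h₂.mul hP
  have m₁₂₃ : Measurable fun a => G₁ a * G₂ a * P a := (h₁.mul h₂).mul hP
  have j₁₂ : Integrable (fun a => G₁ a * G₂ a * gaussWeight β H a) :=
    integrable_mul_gaussWeight_of_sq hβ m₁₂ (integrable_sq_mul2_mul_gaussWeight hβ h₁ h₂ i₁ i₂)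
  have j₁₃ : Integrable (fun a => G₁ a * P a * gaussWeight β H a) :=
    integrable_mul_gaussWeight_of_sq hβ m₁₃ (integrable_sq_mul2_mul_gaussWeight hβ h₁ hP i₁ iP)
  have j₂₃ : Integrable (fun a => G₂ a * P a * gaussWeight β H a) :=
    integrable_mul_gaussWeight_of_sq hβ m₂₃ (integrable_sq_mul2_mul_gaussWeight hβ h₂ hP i₂ iP)
  have j₁₂₃ : Integrable (fun a => G₁ a * G₂ a * P a * gaussWeight β H a) :=
    integrable_mul_gaussWeight_of_sq hβ m₁₂₃ (integrable_sq_mul3_mul_gaussWeight hβ h₁ h₂ hP i₁ i₂ iP)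
  have hw := EdgeChartGaussian.integrable_gaussWeight H hβ
  -- scalar multiples
  have k₁₂ : Integrable (fun a : LandauFree H → E3 => (-b * (G₁ a * G₂ a)) * gaussWeight β H a) :=
    (j₁₂.const_mul (-b)).congr (Filter.Eventually.of_forall fun a => by ring)
  have k₁₃ : Integrable (fun a : LandauFree H → E3 => (-m₂ * (G₁ a * P a)) * gaussWeight β H a) :=
    (j₁₃.const_mul (-m₂)).congr (Filter.Eventually.of_forall fun a => by ring)
  have k₂₃ : Integrable (fun a : LandauFree H → E3 => (-m₁ * (G₂ a * P a)) * gaussWeight β H a) :=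
    (j₂₃.const_mul (-m₁)).congr (Filter.Eventually.of_forall fun a => by ring)
  have k₁ : Integrable (fun a : LandauFree H → E3 => (m₂ * b * G₁ a) * gaussWeight β H a) :=
    (j₁.const_mul (m₂ * b)).congr (Filter.Eventually.of_forall fun a => by ring)
  have k₂ : Integrable (fun a : LandauFree H → E3 => (m₁ * b * G₂ a) * gaussWeight β H a) :=
    (j₂.const_mul (m₁ * b)).congr (Filter.Eventually.of_forall fun a => by ring)
  have k₃ : Integrable (fun a : LandauFree H → E3 => (m₁ * m₂ * P a) * gaussWeight β H a) :=
    (j₃.const_mul (m₁ * m₂)).congr (Filter.Eventually.of_forall fun a => by ring)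
  have k₀ : Integrable (fun a : LandauFree H → E3 => (-(m₁ * m₂ * b)) * gaussWeight β H a) := hw.const_mul _
  -- partial sums
  have s2 : Integrable (fun a : LandauFree H → E3 => (G₁ a * G₂ a * P a + -b * (G₁ a * G₂ a)) * gaussWeight β H a) :=
    (j₁₂₃.add k₁₂).congr (Filter.Eventually.of_forall fun a => by simp only [Pi.add_apply]; ring)
  have s3 : Integrable (fun a : LandauFree H → E3 => (G₁ a * G₂ a * P a + -b * (G₁ a * G₂ a) + -m₂ * (G₁ a * P a)) * gaussWeight β H a) :=
    (s2.add k₁₃).congr (Filter.Eventually.of_forall fun a => by simp only [Pi.add_apply]; ring)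
  have s4 : Integrable (fun a : LandauFree H → E3 => (G₁ a * G₂ a * P a + -b * (G₁ a * G₂ a) + -m₂ * (G₁ a * P a) + -m₁ * (G₂ a * P a)) *
      gaussWeight β H a) := (s3.add k₂₃).congr (Filter.Eventually.of_forall fun a => by simp only [Pi.add_apply]; ring)
  have s5 : Integrable (fun a : LandauFree H → E3 => (G₁ a * G₂ a * P a + -b * (G₁ a * G₂ a) + -m₂ * (G₁ a * P a) + -m₁ * (G₂ a * P a) +
      m₂ * b * G₁ a) * gaussWeight β H a) := (s4.add k₁).congr (Filter.Eventually.of_forall fun a => by simp only [Pi.add_apply]; ring)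
  have s6 : Integrable (fun a : LandauFree H → E3 => (G₁ a * G₂ a * P a + -b * (G₁ a * G₂ a) + -m₂ * (G₁ a * P a) + -m₁ * (G₂ a * P a) +
      m₂ * b * G₁ a + m₁ * b * G₂ a) * gaussWeight β H a) := (s5.add k₂).congr (Filter.Eventually.of_forall fun a => by simp only [Pi.add_apply]; ring)
  have s7 : Integrable (fun a : LandauFree H → E3 => (G₁ a * G₂ a * P a + -b * (G₁ a * G₂ a) + -m₂ * (G₁ a * P a) + -m₁ * (G₂ a * P a) +
      m₂ * b * G₁ a + m₁ * b * G₂ a + m₁ * m₂ * P a) * gaussWeight β H a) :=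
    (s6.add k₃).congr (Filter.Eventually.of_forall fun a => by simp only [Pi.add_apply]; ring)
  have e : (fun a => (G₁ a - m₁) * (G₂ a - m₂) * (P a - b)) = fun a =>
      G₁ a * G₂ a * P a + -b * (G₁ a * G₂ a) + -m₂ * (G₁ a * P a) + -m₁ * (G₂ a * P a) + m₂ * b * G₁ a + m₁ * b * G₂ a + m₁ * m₂ * P a +
        -(m₁ * m₂ * b) := by funext a; ring
  rw [e, EdgeChartGaussian.gaussAvg_add β H s7 k₀, EdgeChartGaussian.gaussAvg_add β H s6 k₃, EdgeChartGaussian.gaussAvg_add β H s5 k₂,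
    EdgeChartGaussian.gaussAvg_add β H s4 k₁, EdgeChartGaussian.gaussAvg_add β H s3 k₂₃, EdgeChartGaussian.gaussAvg_add β H s2 k₁₃,
    EdgeChartGaussian.gaussAvg_add β H j₁₂₃ k₁₂, EdgeChartGaussian.gaussAvg_const_mul, EdgeChartGaussian.gaussAvg_const_mul,
    EdgeChartGaussian.gaussAvg_const_mul, EdgeChartGaussian.gaussAvg_const_mul, EdgeChartGaussian.gaussAvg_const_mul, EdgeChartGaussian.gaussAvg_const_mul,
    EdgeChartGaussian.gaussAvg_const_fun H hβ]
  ring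

/-- `quadVal M` is measurable (it is a certified polynomial, ✓`GaussNormalForm.polyCert_quadVal_sub`). -/
theorem measurable_quadVal (M : Matrix (LandauFree H × Fin 3) (LandauFree H × Fin 3) ℝ) : Measurable (quadVal M : (LandauFree H → E3) → ℝ) := by
  obtain ⟨Q, -, hQ⟩ := GaussNormalForm.polyCert_quadVal_sub (H := H) M 0
  have h : (quadVal M : (LandauFree H → E3) → ℝ) = fun a => MvPolynomial.eval (flatten (LandauFree H) a) Q := by
    funext a; rw [← hQ a, sub_zero]
  rw [h]
  exact (MvPolynomial.continuous_eval Q).measurable.comp (flatten (LandauFree H)).measurable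

/-! ## §2 The quadratic-vertex triangle on `μ_{D′}` -/

/-- ★★ **The exact quadratic-vertex piece of `κ₃,₀` on the cut small-field set** (see the module docstring). -/
theorem abs_tiltCum3_muSet_linCurvSq_linCurvSq_quadVal_le : ∃ C : ℝ, 0 ≤ C ∧ ∀ H : ℕ, 1 ≤ H → ∀ β : ℝ, 0 < β →
    ∀ CM : ℝ, 0 ≤ CM → ∀ M : Matrix (LandauFree H × Fin 3) (LandauFree H × Fin 3) ℝ, M.IsSymm →
    (∀ i j : LandauFree H × Fin 3, |M i j| ≤ CM / (1 + siteDist (i.1.1.1).1 (j.1.1.1).1) ^ 4) →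
    ∀ x y : Site 4, ∀ μ₁ ν₁ μ₂ ν₂ : Fin 4, ∀ s : ℝ, 0 ≤ s → ∀ D : Set (LandauFree H → E3), MeasurableSet D → D ⊆ smallField H s →
    ∀ τ : ℝ, gaussAvg β H (fun a => 1 - D.indicator (fun _ => (1 : ℝ)) a) ≤ τ → τ ≤ 1 / 2 →
    |Tilt.tiltCum3 ((((volume : Measure (LandauFree H → E3)).restrict D).withDensity fun a => ENNReal.ofReal (gaussWeight β H a)))
        (quadVal M) 0 (linCurvSq H (x, μ₁, ν₁)) (linCurvSq H (y, μ₂, ν₂))| ≤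
      β⁻¹ ^ 3 * (C * CM * (1 + Real.log H) ^ 5 / (1 + (((∑ m : Fin 4, |x m - y m|) : ℤ) : ℝ)) ^ 4) +
        Real.sqrt τ * (C * (1 + Real.log H) ^ 2 * (H : ℝ) ^ 2 * Real.sqrt (∑ i, ∑ j, M i j ^ 2) / β ^ 3) := by
  obtain ⟨C₃, hC₃0, hC3⟩ := Cum3Triangle.abs_gaussCum3_linCurvSq_linCurvSq_quadVal_le
  obtain ⟨CV, hCV0, hV⟩ := gaussAvg_centred_linCurvSq_sq_le
  obtain ⟨Cb, hCb0, hb⟩ := GaussNormalForm.gaussAvg_quadVal_centred_sq_le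
  refine ⟨max C₃ (1352 * CV * Real.sqrt Cb), le_max_of_le_left hC₃0, fun H hH β hβ CM hCM M hMs hMk x y μ₁ ν₁ μ₂ ν₂ s hs0 D hDm hDs τ hτ hτ2 => ?_⟩
  set p : Literature.MathematicalPhysics.QuantumFieldTheory.Plaq 4 := (x, μ₁, ν₁) with hp
  set q : Literature.MathematicalPhysics.QuantumFieldTheory.Plaq 4 := (y, μ₂, ν₂) with hq
  have hL1 : 1 ≤ 1 + Real.log H := by
    have : (1 : ℝ) ≤ H := by exact_mod_cast hH
    have h' := Real.log_nonneg this; linarith only [h']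
  have hL0 : 0 ≤ 1 + Real.log H := zero_le_one.trans hL1
  have hH0 : (0 : ℝ) < H := by exact_mod_cast Nat.lt_of_lt_of_le Nat.zero_lt_one hH
  have hSM : 0 ≤ ∑ i, ∑ j, M i j ^ 2 := Finset.sum_nonneg fun i _ => Finset.sum_nonneg fun j _ => sq_nonneg _
  -- ### the Gaussian exact size (w3) and the identification raw = centred
  have hW := hC3 H hH β hβ CM hCM M hMs hMk p q
  have hpq : (((∑ m : Fin 4, |p.1 m - q.1 m|) : ℤ) : ℝ) = (((∑ m : Fin 4, |x m - y m|) : ℤ) : ℝ) := by rw [hp, hq]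
  rw [hpq] at hW
  -- measurability, certificates, sixth moments
  have m₁ : Measurable (linCurvSq H p) := measurable_linCurvSq H p
  have m₂ : Measurable (linCurvSq H q) := measurable_linCurvSq H q
  have mP : Measurable (quadVal M : (LandauFree H → E3) → ℝ) := measurable_quadVal M
  have c₁ := polyCert_linCurvSq H p
  have c₂ := polyCert_linCurvSq H q
  have cP : ∃ Q : MvPolynomial (LandauFree H × Fin 3) ℝ, Q.totalDegree ≤ 2 ∧ ∀ a : LandauFree H → E3,
      quadVal M a = MvPolynomial.eval (flatten (LandauFree H) a) Q := by
    obtain ⟨Q, hQ, h⟩ := GaussNormalForm.polyCert_quadVal_sub (H := H) M 0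
    exact ⟨Q, hQ, fun a => by rw [← h a, sub_zero]⟩
  have i₁ : Integrable (fun a => linCurvSq H p a ^ 6 * gaussWeight β H a) := integrable_polyCert_mul_gaussWeight H hβ (polyCert_pow c₁ 6)
  have i₂ : Integrable (fun a => linCurvSq H q a ^ 6 * gaussWeight β H a) := integrable_polyCert_mul_gaussWeight H hβ (polyCert_pow c₂ 6)
  have iP : Integrable (fun a => quadVal M a ^ 6 * gaussWeight β H a) := integrable_polyCert_mul_gaussWeight H hβ (polyCert_pow cP 6)
  have hraw := gaussAvg_centred_triple_eq_cum3Raw hβ m₁ m₂ mP i₁ i₂ iP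
  -- ### on-`D` bounds (qualitative)
  -- (the edge count is kept opaque: never hand `Fintype.card (LandauFree H)` to `positivity`)
  obtain ⟨N, hN⟩ : ∃ N : ℝ, N = (Fintype.card (LandauFree H) : ℝ) := ⟨_, rfl⟩
  have hN0 : 0 ≤ N := by rw [hN]; exact Nat.cast_nonneg _
  have hK0 : 0 ≤ Real.sqrt (∑ i, ∑ j, M i j ^ 2) * (N * s ^ 2) := mul_nonneg (Real.sqrt_nonneg _) (mul_nonneg hN0 (sq_nonneg s))
  have h16 : 0 ≤ 16 * s ^ 2 := mul_nonneg (by norm_num) (sq_nonneg s)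
  set BD : ℝ := 16 * s ^ 2 + Real.sqrt (∑ i, ∑ j, M i j ^ 2) * (N * s ^ 2) with hBD
  have hBD0 : 0 ≤ BD := add_nonneg h16 hK0
  have hLD : ∀ {z : Site 4} {μ ν : Fin 4}, ∀ a ∈ D, |linCurvSq H (z, μ, ν) a| ≤ BD := by
    intro z μ ν a ha
    have h1 := TiltSup.linCurvSq_le hs0 (hDs ha) z μ ν
    have h0 : 0 ≤ linCurvSq H (z, μ, ν) a := Finset.sum_nonneg fun c _ => sq_nonneg _
    rw [abs_of_nonneg h0, hBD]
    linarith only [h1, hK0]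
  have hPD : ∀ a ∈ D, |quadVal M a| ≤ BD := by
    intro a ha
    refine (TiltSup.abs_quadVal_le M a).trans ?_
    have hcard := TiltSup.sum_norm_sq_le (hDs ha)
    rw [← hN] at hcard
    calc Real.sqrt (∑ i, ∑ j, M i j ^ 2) * ∑ e, ‖a e‖ ^ 2 ≤ Real.sqrt (∑ i, ∑ j, M i j ^ 2) * (N * s ^ 2) :=
          mul_le_mul_of_nonneg_left hcard (Real.sqrt_nonneg _)
      _ ≤ BD := by rw [hBD]; linarith only [h16]
  -- ### the centred Gaussian sizes
  set mp := gaussAvg β H (linCurvSq H p)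
  set mq := gaussAvg β H (linCurvSq H q)
  set mM := gaussAvg β H (quadVal M)
  have hcL : ∀ r : Literature.MathematicalPhysics.QuantumFieldTheory.Plaq 4, ∃ Q : MvPolynomial (LandauFree H × Fin 3) ℝ, Q.totalDegree ≤ 2 ∧
      ∀ a, linCurvSq H r a - gaussAvg β H (linCurvSq H r) = MvPolynomial.eval (flatten (LandauFree H) a) Q := fun r =>
    polyCert_sub (polyCert_linCurvSq H r) (polyCert_const _ 2)
  have hcM : ∃ Q : MvPolynomial (LandauFree H × Fin 3) ℝ, Q.totalDegree ≤ 2 ∧ ∀ a : LandauFree H → E3,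
      quadVal M a - mM = MvPolynomial.eval (flatten (LandauFree H) a) Q := GaussNormalForm.polyCert_quadVal_sub (H := H) M mM
  obtain ⟨u, hu⟩ : ∃ u : ℝ, u = Real.sqrt (CV * (1 + Real.log H) ^ 2 / β ^ 2) := ⟨_, rfl⟩
  obtain ⟨v, hv⟩ : ∃ v : ℝ, v = Real.sqrt (Cb * ((H : ℝ) ^ 4 / β ^ 2) * ∑ i, ∑ j, M i j ^ 2) := ⟨_, rfl⟩
  have hu0 : 0 ≤ u := by rw [hu]; exact Real.sqrt_nonneg _
  have hv0 : 0 ≤ v := by rw [hv]; exact Real.sqrt_nonneg _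
  have hu2 : u ^ 2 = CV * (1 + Real.log H) ^ 2 / β ^ 2 := by
    rw [hu]; exact Real.sq_sqrt (div_nonneg (mul_nonneg hCV0 (sq_nonneg _)) (sq_nonneg _))
  have hHβ : 0 ≤ (H : ℝ) ^ 4 / β ^ 2 := div_nonneg (pow_nonneg hH0.le 4) (sq_nonneg _)
  have hv2 : v ^ 2 = Cb * ((H : ℝ) ^ 4 / β ^ 2) * ∑ i, ∑ j, M i j ^ 2 := by
    rw [hv]; exact Real.sq_sqrt (mul_nonneg (mul_nonneg hCb0 hHβ) hSM)
  have a₁ : gaussAvg β H (fun a => (linCurvSq H p a - mp) ^ 2) ≤ u ^ 2 := (hV H hH β hβ p).trans (le_of_eq hu2.symm)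
  have a₂ : gaussAvg β H (fun a => (linCurvSq H q a - mq) ^ 2) ≤ u ^ 2 := (hV H hH β hβ q).trans (le_of_eq hu2.symm)
  have a₃ : gaussAvg β H (fun a => (quadVal M a - mM) ^ 2) ≤ v ^ 2 := (hb H hH β hβ M).trans (le_of_eq hv2.symm)
  have n₁ : 0 ≤ gaussAvg β H (fun a => (linCurvSq H p a - mp) ^ 2) := EdgeChartGaussian.gaussAvg_nonneg H hβ fun a => sq_nonneg _
  have n₂ : 0 ≤ gaussAvg β H (fun a => (linCurvSq H q a - mq) ^ 2) := EdgeChartGaussian.gaussAvg_nonneg H hβ fun a => sq_nonneg _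
  have n₃ : 0 ≤ gaussAvg β H (fun a => (quadVal M a - mM) ^ 2) := EdgeChartGaussian.gaussAvg_nonneg H hβ fun a => sq_nonneg _
  -- Bonami–Nelson products (degrees 2,2 → 81; 4,2 → 729)
  have A12 : gaussAvg β H (fun a => ((linCurvSq H p a - mp) * (linCurvSq H q a - mq)) ^ 2) ≤ 81 * (u ^ 2 * u ^ 2) := by
    have h := gaussAvg_sq_mul_sq_le_of_polyCert H hβ (hcL p) (hcL q)
    rw [show ((3 : ℝ) ^ (2 + 2)) = 81 by norm_num, mul_assoc] at h
    refine le_trans (le_of_eq (congrArg _ (funext fun a => by ring))) (h.trans ?_)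
    exact mul_le_mul_of_nonneg_left (mul_le_mul a₁ a₂ n₂ (sq_nonneg u)) (by norm_num)
  have A13 : gaussAvg β H (fun a => ((linCurvSq H p a - mp) * (quadVal M a - mM)) ^ 2) ≤ 81 * (u ^ 2 * v ^ 2) := by
    have h := gaussAvg_sq_mul_sq_le_of_polyCert H hβ (hcL p) hcM
    rw [show ((3 : ℝ) ^ (2 + 2)) = 81 by norm_num, mul_assoc] at h
    refine le_trans (le_of_eq (congrArg _ (funext fun a => by ring))) (h.trans ?_)
    exact mul_le_mul_of_nonneg_left (mul_le_mul a₁ a₃ n₃ (sq_nonneg u)) (by norm_num)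
  have A23 : gaussAvg β H (fun a => ((linCurvSq H q a - mq) * (quadVal M a - mM)) ^ 2) ≤ 81 * (u ^ 2 * v ^ 2) := by
    have h := gaussAvg_sq_mul_sq_le_of_polyCert H hβ (hcL q) hcM
    rw [show ((3 : ℝ) ^ (2 + 2)) = 81 by norm_num, mul_assoc] at h
    refine le_trans (le_of_eq (congrArg _ (funext fun a => by ring))) (h.trans ?_)
    exact mul_le_mul_of_nonneg_left (mul_le_mul a₂ a₃ n₃ (sq_nonneg u)) (by norm_num)
  have A123 : gaussAvg β H (fun a => ((linCurvSq H p a - mp) * (linCurvSq H q a - mq) * (quadVal M a - mM)) ^ 2) ≤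
      729 * (81 * (u ^ 2 * u ^ 2) * v ^ 2) := by
    have h := gaussAvg_sq_mul_sq_le_of_polyCert H hβ (polyCert_mul (hcL p) (hcL q)) hcM
    rw [show ((3 : ℝ) ^ (2 + 2 + 2)) = 729 by norm_num, mul_assoc] at h
    refine le_trans (le_of_eq (congrArg _ (funext fun a => by ring))) (h.trans ?_)
    refine mul_le_mul_of_nonneg_left (mul_le_mul A12 a₃ n₃ (mul_nonneg (by norm_num) (mul_nonneg (sq_nonneg u) (sq_nonneg u)))) (by norm_num)
  -- ### the centred transfer
  have key := abs_tiltCum3_muSet_zero_sub_gaussAvg_centred_le hβ hDm hτ hτ2 m₁ m₂ mP hBD0 hLD hLD hPD i₁ i₂ iP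
    a₁ a₂ a₃ A12 A13 A23 A123
  rw [hraw] at key
  -- ### bookkeeping
  have hτ0 : 0 ≤ Real.sqrt τ := Real.sqrt_nonneg _
  have s1 : Real.sqrt (u ^ 2) = u := Real.sqrt_sq hu0
  have s3 : Real.sqrt (v ^ 2) = v := Real.sqrt_sq hv0
  have s12 : Real.sqrt (81 * (u ^ 2 * u ^ 2)) = 9 * (u * u) := by
    rw [show 81 * (u ^ 2 * u ^ 2) = (9 * (u * u)) ^ 2 by ring]; exact Real.sqrt_sq (mul_nonneg (by norm_num) (mul_nonneg hu0 hu0))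
  have s13 : Real.sqrt (81 * (u ^ 2 * v ^ 2)) = 9 * (u * v) := by
    rw [show 81 * (u ^ 2 * v ^ 2) = (9 * (u * v)) ^ 2 by ring]; exact Real.sqrt_sq (mul_nonneg (by norm_num) (mul_nonneg hu0 hv0))
  have s123 : Real.sqrt (729 * (81 * (u ^ 2 * u ^ 2) * v ^ 2)) = 243 * (u * u * v) := by
    rw [show 729 * (81 * (u ^ 2 * u ^ 2) * v ^ 2) = (243 * (u * u * v)) ^ 2 by ring]; exact Real.sqrt_sq (mul_nonneg (by norm_num) (mul_nonneg (mul_nonneg hu0 hu0) hv0))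
  rw [s1, s3, s12, s13, s123] at key
  -- `u²v` in letters
  have huv : u * u * v = CV * (1 + Real.log H) ^ 2 / β ^ 2 * (Real.sqrt Cb * ((H : ℝ) ^ 2 / β) * Real.sqrt (∑ i, ∑ j, M i j ^ 2)) := by
    rw [← sq, hu2, hv, Real.sqrt_mul (mul_nonneg hCb0 hHβ), Real.sqrt_mul hCb0,
      show (H : ℝ) ^ 4 / β ^ 2 = ((H : ℝ) ^ 2 / β) ^ 2 by ring, Real.sqrt_sq (div_nonneg (pow_nonneg hH0.le 2) hβ.le)]
  have hb : |Tilt.tiltCum3 ((((volume : Measure (LandauFree H → E3)).restrict D).withDensity fun a => ENNReal.ofReal (gaussWeight β H a)))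
        (quadVal M) 0 (linCurvSq H p) (linCurvSq H q) -
      (gaussAvg β H (fun a => linCurvSq H p a * linCurvSq H q a * quadVal M a) - mp * gaussAvg β H (fun a => linCurvSq H q a * quadVal M a) -
        mq * gaussAvg β H (fun a => linCurvSq H p a * quadVal M a) - mM * gaussAvg β H (fun a => linCurvSq H p a * linCurvSq H q a) +
        2 * (mp * mq * mM))| ≤ Real.sqrt τ * (1352 * (u * u * v)) := key.trans (le_of_eq (by ring))
  have htri := abs_sub_abs_le_abs_sub (Tilt.tiltCum3 ((((volume : Measure (LandauFree H → E3)).restrict D).withDensity fun a =>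
      ENNReal.ofReal (gaussWeight β H a))) (quadVal M) 0 (linCurvSq H p) (linCurvSq H q))
    (gaussAvg β H (fun a => linCurvSq H p a * linCurvSq H q a * quadVal M a) - mp * gaussAvg β H (fun a => linCurvSq H q a * quadVal M a) -
        mq * gaussAvg β H (fun a => linCurvSq H p a * quadVal M a) - mM * gaussAvg β H (fun a => linCurvSq H p a * linCurvSq H q a) +
        2 * (mp * mq * mM))
  have hmain : |Tilt.tiltCum3 ((((volume : Measure (LandauFree H → E3)).restrict D).withDensity fun a => ENNReal.ofReal (gaussWeight β H a)))
      (quadVal M) 0 (linCurvSq H p) (linCurvSq H q)| ≤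
      β⁻¹ ^ 3 * (C₃ * CM * (1 + Real.log H) ^ 5 / (1 + (((∑ m : Fin 4, |x m - y m|) : ℤ) : ℝ)) ^ 4) + Real.sqrt τ * (1352 * (u * u * v)) := by
    linarith only [hW, hb, htri]
  refine hmain.trans (add_le_add ?_ ?_)
  · have hd0 : 0 ≤ 1 + (((∑ m : Fin 4, |x m - y m|) : ℤ) : ℝ) := by
      have : (0 : ℤ) ≤ ∑ m : Fin 4, |x m - y m| := Finset.sum_nonneg fun m _ => abs_nonneg _
      have : (0 : ℝ) ≤ (((∑ m : Fin 4, |x m - y m|) : ℤ) : ℝ) := by exact_mod_cast this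
      linarith only [this]
    refine mul_le_mul_of_nonneg_left (div_le_div_of_nonneg_right (mul_le_mul_of_nonneg_right
      (mul_le_mul_of_nonneg_right (le_max_left _ _) hCM) (pow_nonneg hL0 5)) (pow_nonneg hd0 4)) (pow_nonneg (inv_nonneg.2 hβ.le) 3)
  · refine mul_le_mul_of_nonneg_left ?_ hτ0
    rw [huv]
    have hden : 0 < β ^ 3 := pow_pos hβ 3
    rw [le_div_iff₀ hden]
    have e1 : 1352 * (CV * (1 + Real.log H) ^ 2 / β ^ 2 * (Real.sqrt Cb * ((H : ℝ) ^ 2 / β) * Real.sqrt (∑ i, ∑ j, M i j ^ 2))) * β ^ 3 =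
        (1352 * CV * Real.sqrt Cb) * ((1 + Real.log H) ^ 2 * (H : ℝ) ^ 2 * Real.sqrt (∑ i, ∑ j, M i j ^ 2)) := by
      field_simp
    rw [e1]
    have hfac : 0 ≤ (1 + Real.log H) ^ 2 * (H : ℝ) ^ 2 * Real.sqrt (∑ i, ∑ j, M i j ^ 2) :=
      mul_nonneg (mul_nonneg (pow_nonneg hL0 2) (pow_nonneg hH0.le 2)) (Real.sqrt_nonneg _)
    calc (1352 * CV * Real.sqrt Cb) * ((1 + Real.log H) ^ 2 * (H : ℝ) ^ 2 * Real.sqrt (∑ i, ∑ j, M i j ^ 2))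
        ≤ max C₃ (1352 * CV * Real.sqrt Cb) * ((1 + Real.log H) ^ 2 * (H : ℝ) ^ 2 * Real.sqrt (∑ i, ∑ j, M i j ^ 2)) :=
          mul_le_mul_of_nonneg_right (le_max_right _ _) hfac
      _ = _ := by ring


end GaussRestrict

end Summit.QuantumFields.YangMills.Theorems.AllWindowsColdBoxBoxHighLine

end
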